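import Literature.NumberTheory.EllipticCurves.BurungaleSkinnerTianWan2024.GreenbergMainStatementOPEN
import HarnessLib

/-!
# Burungale–Skinner–Tian–Wan (arXiv:2409.01350v2, PREPRINT), §6 "Zeta elements over imaginary
# quadratic fields: the supersingular case": EXISTENCE of the integral two-variable Greenberg `p`-adic
# `L`-function `𝓛_p^Gr(g/L) ∈ Λ_{L,𝒪_λ^ur}` at a SUPERSINGULAR prime (§6.4, §6.6.1, Explicit
# Reciprocity Law II′ = Thm. 6.17) — an explicitly labelled OPEN binder (claim-tagged; NEVER a fact)
# in the tree's currency `IsGreenbergLFunctionAnyRoot₂` (`GreenbergMainStatementOPEN.lean`)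

Work item `wi-78170` (route `SignedBaseChange` of the BSD summit, item `GreenbergFramesAtSupersingular`,
part (B)): "the supersingular analogue of Yan–Zhu Thm. 3.9 / Def. 3.11"
(`YanZhu2026.thm39_def311_exists_isGreenbergLFunctionAnyRoot₂`, ORDINARY `p` only, refereed). The
sibling `GreenbergMainStatementOPEN.lean` records (module docstring, "WHAT IS NOT HERE"): "existence of
the frames at a supersingular `p` (Yan–Zhu's `thm39_def311_…` supplies them at ordinary `p` only; BSTW
… is PREPRINT)". This file types that existence statement, with the conventions of the sibling:
UNREFEREED preprint ⇒ an explicitly labelled OPEN hypothesis (`def … : Prop`,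
`[claim: …, status: under-review]`), NEVER a theorem, NEVER a `[cite:]`-fact, no `_holds`; nothing is
asserted about any curve. ZERO new definitions with content; ONE binder; two bookkeeping projections
PROVED.

## Printed statements (arXiv:2409.01350v2; store text `paper:arxiv-2409.01350` = the TeX, 3000-char
## chunks `pNNNN`; printed numbers from the litref concordance
## `pub/bsd-litref/bstw24/sheets/LABELS-bstw24-v2.tsv` (exact for theorem-like items; TeX lines
## body-relative, absolute = body + 257))

* §6 preamble (body l.4599; [p0049 L13–14]): "We continue with the notation and conventions introduced
  in §2–§4. Throughout this section we assume the newform `g ∈ S₂(Γ₀(N))` to be supersingular at `p`."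
  — §2.2.11 [p0016 L20–23]: "The supersingular case. This is the case where `p ∤ N` and `a_g(p) = 0`
  … In this case we say that `g` is supersingular." §2.1.1 [p0012 L12]: "Throughout `p ≥ 3` will be an
  odd prime." §2.5.1 (IQF) [p0018 L108–120]: "`L ⊂ ℚ̄` will denote an imaginary quadratic field of
  discriminant `−D_L < 0` … We will always suppose that `p` splits in `L`: `(p) = v v̄` with `v`
  determined via `ι_p`, and that `N_L` is squarefree" (`N_L` = the part of `N` supported at primes
  dividing `D_L`; empty when `(N, D_L) = 1`, the Introduction's (h1), §1.2.1 [p0005 L134]).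
* §6.4 "Integral normalisations" [p0054 L24, L55–65]: "Define `𝓑𝓕^∘(g/L) = 𝐜⁻¹ · _c𝓑𝓕^∘(g/L)` … and
  `𝓛_p^∘(g/L) = 𝒞^int_∘(loc_p(𝓑𝓕^∘(g/L))) ∈ 𝓡` and `𝓛_p^Gr(g/L) = 𝓛^int_∘(loc_p(𝓑𝓕^∘(g/L))) ∈ 𝓡^ur`."
* **Theorem 6.17 (Explicit Reciprocity Law II′; label `ERLIIint-thm-ss`, body l.5308; [p0054
  L91–110]).** "The element `𝓛_p^Gr(g/L) ∈ 𝓡^ur` satisfies: For `χ ∈ Ξ^(II)`,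
  `φ_χ(𝓛_p^Gr(g/L)) = − w_L (χ₁(γ_v) − 1) 𝓔′(χ) · n!(n−1)! π^{2m−2n−1} / (2^{2n−2m+2} D_L^{m/2}) · Ω_p^{2m}
  L(1, g, ψ_χ)/Ω_∞^{2m}`, where `𝓔′(χ) = (1 − a(p)ψ_χ(ϖ_v̄)⁻¹p⁻¹ + ψ_χ(ϖ_v̄)⁻²p⁻¹)²` if `ζ = 1`,
  `n ≡ 0 mod p − 1`, and `(p^{t+1}/𝔤(ψ_ζ⁻¹ωⁿ))² (p^{2n−1}/χ₁(ϖ_v̄))^{t+1}` else. Here `(Ω_p, Ω_∞)` are the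
  CM periods as in Theorem (pKatzL) [= Katz's `p`-adic `L`-function of `L`, §4] and
  `L(s, g, ψ_χ) = Σ_{(𝔞,𝔣_{ψ_χ})=1} a_g(N𝔞) ψ_χ(x_𝔞) N𝔞^{−s}`." (Proof sketch printed: Shimura's formula for
  `⟨h⁰_{v,χ₁}, h⁰_{v,χ₁}⟩` via `h_L … L(1, χ₁/χ₁^c)` "combined with the interpolation formula for the Katz
  `p`-adic `L`-function 𝓛_v(L) from Theorem (pKatzL)", [p0054 L112–127]; Remark 6.18: independent of `c`.)
* §6.6.1 "The zeta element `𝒵^∘(g/L)`" (item 6.24, label `two-variable-zeta-ss`, body l.5497–5575;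
  [p0056 L45–p0057 L31]): the two-variable zeta element `𝒵^∘(g/L) ∈ H¹_{rel,∘}(L, T(1) ⊗̂ Λ_L)` "in the
  supersingular case", the map `𝓛^∘_v̄ : H¹_∘(L_v̄, T(1) ⊗̂ Λ_L) ↪ Λ_{L,𝒪_λ^ur}` and "We also let
  `𝓛_p^Gr(g/L) = 𝓛^∘_v̄(loc_v̄(𝒵^∘(g/L))) ∈ Λ_{L,𝒪_λ^ur}`. So `𝓛_p^Gr(g/L) = θ^{ur,−1}(𝓛_p^Gr(g/L))`."
* Introduction §1.2.1 [p0006 L49–56]: "Let `𝓛_p^Gr(E/L) ∈ Λ_L^ur` be the associated Rankin–Selberg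
  `p`-adic `L`-function interpolating the algebraic part of `L`-values `L(1, E/L ⊗ χ)` for certain infinite
  order Hecke characters `χ` over `L`, referred to as a Greenberg `p`-adic `L`-function. Note that it is a
  bounded measure independent of the type of reduction of `E` at `p`." **Theorem 1.14** (label `thmZ`,
  [p0006 L68–83]): for `E/ℚ` of conductor `N`, `p ∤ 2N` (with (h4) `a_p(E) = 0` if `p = 3` is
  supersingular — "automatic for `p ≥ 5`", [p0006 L13–17]), `L` imaginary quadratic with (h1)
  `(D_L, N) = 1`, (h2) `p = v v̄` split, (h3) `E[p](L) = 0`, "there exists a zeta element `𝒵^·(E/L)` …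
  such that … `Log^·_v̄(loc_v̄(𝒵^·(E/L))) = 𝓛_p^Gr(E/L)`"; Remark 1.15 (i): "(h1) and (h3) are not
  essential. Without them, the explicit reciprocity laws merely have a slightly different appearance."

LOCATOR NOTE for the requester: the item's locator "Thm. 5.11 (ERLIIint-thm, l.4278) + §5.4
(l.4683–4705)" is the ORDINARY twin (§5 "the ordinary case", body l.… "Throughout this section we assume
`g` to be ordinary at `p`" [p0037 L16]; Thm. 5.11 = ERL II′ there, §5.5.1 item 5.24
`two-variable-zeta`); at a supersingular `p` the printed carriers are §6.4 / Thm. 6.17 / §6.6.1 above —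
same shape, `T^±` replaced by Kobayashi's `∘ = ±` conditions.

## Transcription (E-instances `g = f_E`, `L = K`, `𝒪_λ = ℤ_p`) and what currency

EXACTLY the binder list of the consumer (`Summits/…/Theses/SignedBaseChange.lean`,
`GreenbergFramesAtSupersingular`) and EXACTLY the conclusion shape of the refereed ordinary twin
`YanZhu2026.thm39_def311_exists_isGreenbergLFunctionAnyRoot₂`: `W` globally minimal, `f` its newform at
level `N = N_E` (`IsNewformOf`), `5 ≤ p` (print: `p` odd, (h4) at `p = 3` — WEAKER), `p ∤ N_E` and
`a_p(E) = 0` (`W.frobeniusTrace p = 0`; = "supersingular" of §2.2.11), `K` imaginary quadratic, (h2)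
`#primesOver p = 2`, `p ∈ v`, `p ∈ v̄`, `v̄ ≠ v`, `v` induced by `ι` (the sibling's clause), (h1)
`IsCoprime N D_K` (⇒ (IQF)'s "`N_L` squarefree"), `(κ₁, κ₂)` THE cyclotomic / anticyclotomic
`ℤ_p`-extensions with an adapted generator pair `(γ₁, γ₂)` (the identification `Γ_L ≅ Γ_L^v × Γ` of
§6.6.1 is absorbed in the two-variable frame, as in the sibling); CONCLUSION: there are Katz–de Shalit
period data `(Ω ≠ 0, δ² = ±D_K, Ω_p ∈ (ℤ_p^ur)ˣ)`, a series `LK` which IS Katz's two-variable measure at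
the inverse generators (`IsKatzMeasure₂ ι v v̄ ∅ κ₁ κ₂ γ₁⁻¹ γ₂⁻¹ 1 Ω δ Ω_p LK` — the "(Ω_p, Ω_∞) as in
Theorem (pKatzL)" of Thm. 6.17) and a series `G ∈ 𝒪_{ℂ_p}⟦T₁⟧⟦T₂⟧` which IS `𝓛_p^Gr(f/K)` in the
reduction-type-free, continuation-bound value frame `IsGreenbergLFunctionAnyRoot₂ ι v v̄ κ₁ κ₂ γ₁⁻¹ γ₂⁻¹
f |D_K| h_K LK G` of the sibling file (values at EVERY root `α` of `x² − a_p x + p`; at a supersingular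
`p` both roots have valuation `½` and Thm. 6.17's factor `𝓔′` is the symmetric one,
`typeTwoEulerFactor_div`). (h3) `E[p](K) = 0` is NOT a binder: for `p ≥ 5` supersingular and split in
`K` it holds automatically (`E[p](K) ⊂ E(K_v)[p] = E(ℚ_p)[p] = 0`: `Ẽ(𝔽_p)` has order `p + 1`, prime
to `p`, and the formal group `Ê(pℤ_p)` is torsion-free for odd `p`), and Remark 1.15 (i) says it is
inessential anyway ("without [(h1), (h3)] the explicit reciprocity laws merely have a slightly different
appearance").

WEAKER-OR-EQUAL to print in every binder, with the sibling's two READING FLAGS inherited verbatim (the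
conclusion is the cell-refereed reading of BSTW's `𝓛_p^Gr` in the Yan–Zhu / CGS product currency
`𝓛_p^Gr = h_K · 𝓛_𝔭(K)' · 𝓛_p^II`, `BSTW-924-conjugate-convention`; `(L_p^Gr)_{CGS} = (c_*𝓛_p^Gr)_{BSTW}`
is cell-refereed, NOT in print) — hence claim-tagged twice over. NOT TYPED (and why): the
"∀-over-frames" form "(b) over EVERY Katz frame there exists `G`" of the consumer's item — print
constructs ONE `𝓛_p^Gr(g/L)` relative to the periods of its Theorem (pKatzL); passing to an arbitrary
frame `(Ω', δ', Ω_p', LK')` is a period-rescaling statement that is not printed (and is what the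
`∃`-shape makes unnecessary: a `∀`-over-frames package is instantiated by ONE inhabited frame, exactly as
the ordinary twin `thm39_def311_…` is consumed); `ℤ_p^ur`-rationality of `G` (WEAKER: `G ∈ 𝒪_{ℂ_p}⟦T₁,T₂⟧`);
the zeta element itself and ERL I′ (Thm. 6.16); the `𝒪_λ ≠ ℤ_p` generality.

CONSUMER: `GreenbergFramesAtSupersingular` (F, construction half of K2) closes from THIS binder (both
its conjunct (a) and an inhabited instance of (b)) after the planner's restate of (b) to the `∃`-shape;
part (A) alone is also de Shalit's `thmII417_exists_katzSheet`.

## References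
* [BurungaleSkinnerTianWan2024] A. Burungale, C. Skinner, Y. Tian, X. Wan, *Zeta elements for elliptic
  curves and applications*, arXiv:2409.01350v2 (PREPRINT): §6 (body l.4599), §6.4, Thm. 6.17
  (ERLIIint-thm-ss, l.5308), Rem. 6.18, §6.6.1 (two-variable-zeta-ss, l.5497–5575), §1.2.1 (h1)–(h4),
  Thm. 1.14 (thmZ), Rem. 1.15, §2.1.1, §2.2.11, §2.5.1 (IQF).
* [YanZhu2024MainConjNonCM] J. Algebra 693 (2026), Thm. 3.9 / Def. 3.11 — the ordinary twin (tree).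
* [CastellaGrossiSkinner2025] Math. Ann. 393, Def. 2.4.3 / Thm. 2.4.1 — the same currency (tree).
* [deShalit1987] II.4.16–4.17 — the Katz frame `IsKatzMeasure₂` (tree).
-/

noncomputable section

open scoped Classical

open PowerSeries NumberField IsDedekindDomain Field CongruenceSubgroup Polynomial
  Literature.NumberTheory.GaloisRepresentations Literature.NumberTheory.EllipticCurves
  Literature.NumberTheory.EllipticCurves.ModularForms Literature.NumberTheory.EllipticCurves.Rank1Residual

namespace Literature.NumberTheory.EllipticCurves.BurungaleSkinnerTianWan2024

/-- **OPEN HYPOTHESIS — UNREFEREED PREPRINT (arXiv:2409.01350v2), §6.4 + §6.6.1 + Thm. 6.17 (Explicit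
Reciprocity Law II′, supersingular case), for an elliptic curve: at a prime `p ≥ 5` of good
SUPERSINGULAR reduction (`a_p(E) = 0`, `p ∤ N_E`), split in the imaginary quadratic field `K` with
`(N_E, D_K) = 1`, the integral two-variable Greenberg `p`-adic `L`-function `𝓛_p^Gr(f_E/K) ∈ Λ_K^ur`
EXISTS** — "`𝓛_p^Gr(g/L) = 𝓛^∘_v̄(loc_v̄(𝒵^∘(g/L))) ∈ Λ_{L,𝒪_λ^ur}`" (§6.6.1), "a bounded measure
independent of the type of reduction of `E` at `p`" (§1.2.1), with the Rankin–Selberg interpolation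
property of Thm. 6.17 on the type-II range. Transcribed (module docstring) with EXACTLY the binders of
the consumer `GreenbergFramesAtSupersingular` and EXACTLY the conclusion shape of the refereed ordinary
twin `YanZhu2026.thm39_def311_exists_isGreenbergLFunctionAnyRoot₂`: there are Katz–de Shalit period
data `(Ω ≠ 0, δ² = ±D_K, Ω_p ∈ (ℤ_p^ur)ˣ)`, a series `LK` in the Katz frame `IsKatzMeasure₂ ι v v̄ ∅ κ₁ κ₂
γ₁⁻¹ γ₂⁻¹ 1 Ω δ Ω_p LK`, and a series `G ∈ 𝒪_{ℂ_p}⟦T₁⟧⟦T₂⟧` in the reduction-type-free Greenberg value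
frame `IsGreenbergLFunctionAnyRoot₂ ι v v̄ κ₁ κ₂ γ₁⁻¹ γ₂⁻¹ f |D_K| h_K LK G`. READING FLAGS
`BSTW-924-conjugate-convention` and "(L_p^Gr)_{CGS} = (c_*𝓛_p^Gr)_{BSTW}" (cell-refereed, not in print)
as in the sibling binder `thm924_…_OPEN`. NEVER cite this `Prop` as a theorem.
[claim: BurungaleSkinnerTianWan2024, status: under-review]
[cite: BurungaleSkinnerTianWan2024, §6.6.1 (item 6.24 two-variable-zeta-ss, TeX body l.5497–5575: 𝓛_p^Gr(g/L) ∈ Λ_{L,𝒪_λ^ur}) with §6.4 (Integral normalisations) and Thm. 6.17 (ERLIIint-thm-ss, l.5308); §1.2.1 and Thm. 1.14 (thmZ) (ANNOUNCED, OPEN binder)] -/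
def thm617_exists_isGreenbergLFunctionAnyRoot₂_supersingular_PRE : Prop :=
  ∀ {p : ℕ} [Fact p.Prime] (ι : PadicAlgCl p ≃+* ℂ) (W : WeierstrassCurve ℚ) [W.IsElliptic]
    [W.IsGloballyMinimal] (K : Type) [Field K] [NumberField K] (v vbar : HeightOneSpectrum (𝓞 K))
    (κ₁ κ₂ : ZpExtension K p) (γ₁ γ₂ : absoluteGaloisGroup K)
    [Fact (ZpExtension.IsTopGeneratorPair κ₁ κ₂ γ₁ γ₂)] {N : ℕ} [NeZero N] {f : CuspForm (Gamma0 N) 2}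
    (_ : IsNewformOf W f) [NeZero (NumberField.discr K).natAbs],
    -- `g = f_E` of level `N = N_E`; `p ≥ 5` of good SUPERSINGULAR reduction: `p ∤ N_E`, `a_p(E) = 0`
    (N : ℤ) = W.conductorNorm ℤ → 5 ≤ p → ¬ (p : ℤ) ∣ W.conductorNorm ℤ → W.frobeniusTrace p = 0 →
    -- `L = K` imaginary quadratic; (h2) `p = v v̄` split, `v` induced by `ι`; (h1) `(N, D_K) = 1`
    IsImaginaryQuadratic K → ((Ideal.span {(p : ℤ)}).primesOver (𝓞 K)).ncard = 2 →
    ((p : ℕ) : 𝓞 K) ∈ v.asIdeal → ((p : ℕ) : 𝓞 K) ∈ vbar.asIdeal → vbar ≠ v →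
    (∀ (w : InfinitePlace K) (k : 𝓞 K), k ∈ v.asIdeal ↔ ‖ι.symm (w.embedding (k : K))‖ < 1) →
    IsCoprime (N : ℤ) (NumberField.discr K) →
    -- the `ℤ_p²`-tower: `κ₁` cyclotomic, `κ₂` anticyclotomic, generator pair `(γ₁, γ₂)`
    κ₁.IsCyclotomic → κ₂.IsAnticyclotomic →
    -- a Katz frame (period data + Katz's two-variable measure) and `G = 𝓛_p^Gr(f/K)` in it
    ∃ (Ω δ : ℂ) (Ωp : (unrIntegers p)ˣ) (LK G : PowerSeries (PowerSeries (PadicComplexInt p))),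
      Ω ≠ 0 ∧ (δ ^ 2 = (NumberField.discr K : ℂ) ∨ δ ^ 2 = -(NumberField.discr K : ℂ)) ∧
      IsKatzMeasure₂ ι v vbar ∅ κ₁ κ₂ γ₁⁻¹ γ₂⁻¹ 1 Ω δ ((Ωp : unrIntegers p) : ℂ_[p]) LK ∧
      IsGreenbergLFunctionAnyRoot₂ ι v vbar κ₁ κ₂ γ₁⁻¹ γ₂⁻¹ f (NumberField.discr K).natAbs
        (NumberField.classNumber K) LK G

/-! ### Bookkeeping: the two conjunct shapes of the consumer `GreenbergFramesAtSupersingular` -/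

section Shapes

variable {p : ℕ} [Fact p.Prime] {K : Type} [Field K] [NumberField K] {N : ℕ}

/-- From ONE inhabited Katz/Greenberg frame (the conclusion shape of the binder and of the ordinary
twin): conjunct (a) of the consumer — a Katz frame exists. Pure logic; asserts nothing about curves.
[cite: YanZhu2024MainConjNonCM, Thm. 3.9 with Def. 3.11 (arXiv:2412.20078v4 TeX l.839–871) (shape)] -/
theorem exists_katzFrame_of_exists_frame {ι : PadicAlgCl p ≃+* ℂ} {v vbar : HeightOneSpectrum (𝓞 K)}
    {κ₁ κ₂ : ZpExtension K p} {g₁ g₂ : absoluteGaloisGroup K} {f : CuspForm (Gamma0 N) 2}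
    {D : ℕ} [NeZero D] {hK : ℕ} {d : ℂ}
    (h : ∃ (Ω δ : ℂ) (Ωp : (unrIntegers p)ˣ) (LK G : PowerSeries (PowerSeries (PadicComplexInt p))),
      Ω ≠ 0 ∧ (δ ^ 2 = d ∨ δ ^ 2 = -d) ∧
      IsKatzMeasure₂ ι v vbar ∅ κ₁ κ₂ g₁ g₂ 1 Ω δ ((Ωp : unrIntegers p) : ℂ_[p]) LK ∧
      IsGreenbergLFunctionAnyRoot₂ ι v vbar κ₁ κ₂ g₁ g₂ f D hK LK G) :
    ∃ (Ω δ : ℂ) (Ωp : (unrIntegers p)ˣ) (LK : PowerSeries (PowerSeries (PadicComplexInt p))),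
      Ω ≠ 0 ∧ (δ ^ 2 = d ∨ δ ^ 2 = -d) ∧
      IsKatzMeasure₂ ι v vbar ∅ κ₁ κ₂ g₁ g₂ 1 Ω δ ((Ωp : unrIntegers p) : ℂ_[p]) LK := by
  obtain ⟨Ω, δ, Ωp, LK, _, hΩ, hδ, hLK, -⟩ := h
  exact ⟨Ω, δ, Ωp, LK, hΩ, hδ, hLK⟩

/-- From ONE inhabited Katz/Greenberg frame: an INHABITED instance of conjunct (b) of the consumer —
some Katz frame over which a Greenberg series `G` exists (which is all a `∀`-over-frames package
needs to be non-vacuous). Pure logic; asserts nothing about curves.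
[cite: YanZhu2024MainConjNonCM, Thm. 3.9 with Def. 3.11 (arXiv:2412.20078v4 TeX l.839–871) (shape)] -/
theorem exists_katzFrame_and_greenberg_of_exists_frame {ι : PadicAlgCl p ≃+* ℂ}
    {v vbar : HeightOneSpectrum (𝓞 K)} {κ₁ κ₂ : ZpExtension K p} {g₁ g₂ : absoluteGaloisGroup K}
    {f : CuspForm (Gamma0 N) 2} {D : ℕ} [NeZero D] {hK : ℕ} {d : ℂ}
    (h : ∃ (Ω δ : ℂ) (Ωp : (unrIntegers p)ˣ) (LK G : PowerSeries (PowerSeries (PadicComplexInt p))),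
      Ω ≠ 0 ∧ (δ ^ 2 = d ∨ δ ^ 2 = -d) ∧
      IsKatzMeasure₂ ι v vbar ∅ κ₁ κ₂ g₁ g₂ 1 Ω δ ((Ωp : unrIntegers p) : ℂ_[p]) LK ∧
      IsGreenbergLFunctionAnyRoot₂ ι v vbar κ₁ κ₂ g₁ g₂ f D hK LK G) :
    ∃ (Ω δ : ℂ) (Ωp : (unrIntegers p)ˣ) (LK : PowerSeries (PowerSeries (PadicComplexInt p))),
      (Ω ≠ 0 ∧ (δ ^ 2 = d ∨ δ ^ 2 = -d) ∧
        IsKatzMeasure₂ ι v vbar ∅ κ₁ κ₂ g₁ g₂ 1 Ω δ ((Ωp : unrIntegers p) : ℂ_[p]) LK) ∧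
      ∃ G : PowerSeries (PowerSeries (PadicComplexInt p)),
        IsGreenbergLFunctionAnyRoot₂ ι v vbar κ₁ κ₂ g₁ g₂ f D hK LK G := by
  obtain ⟨Ω, δ, Ωp, LK, G, hΩ, hδ, hLK, hG⟩ := h
  exact ⟨Ω, δ, Ωp, LK, ⟨hΩ, hδ, hLK⟩, G, hG⟩

end Shapes

/-! ### §2. The COMMON Katz frame — print's quantifier order «the Katz function of `L` (Thm. 4.19),
then EVERY newform `g` supersingular at `p`» (appended 2026-08-27 by the typing seat `bsd-wall-ty-2` of
the cell `pub/bsd-wall`, at the request of the planner of route `SignedBaseChange` (`bsd-wall-ss`,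
items GSF / K2R′); the §1 binder and its two projections above are untouched)

PRINTED (arXiv:2409.01350v2; the v2 TeX `main.tex` held at `run/shared/lean/pub/bsd-eis/lit/src/bstw24-v2/`,
ABSOLUTE line numbers — body-relative as used in §1 = absolute − 257; printed numbers from the
concordance `run/shared/lean/pub/bsd-littype/staging/bsd-littype-01/numbering.tsv`):

* **Theorem 4.19** (label `pKatzL`, l.3606–3618; store chunk [p0036]): "There exists an unique
  `𝓛_v(L) ∈ Λ_L^{v,ur} = Λ^v_{L,W(𝔽̄_p)}` such that for any continuous `W(𝔽̄_p)`-linear homomorphism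
  `θ : Λ_L^{v,ur} → ℚ̄_p` such that `θ(γ_v^{h_p}) = ε(γ⁺)^m` for some `m ≡ 0 mod (p−1)`, `m ≥ 0`,
  `θ(𝓛_v(L))/Ω_p^{2m} = (1 − p^m ψ_θ(ϖ_v̄)⁻²) · (1 − p^{m−1} ψ_θ(ϖ_v̄)⁻²) (w_L/2) · π^{m−1}·m!/√D_L^{m−1} ·
  L(1, ψ_θ/ψ_θ^c)/Ω_∞^{2m}`, where `ψ_θ` is the algebraic Hecke character such that `σ_{ψ_θ}` is the
  (composite) `p`-adic character `G_L ↠ Γ_L^v →θ ℚ̄_p^×`, and `(Ω_p, Ω_∞) ∈ W(𝔽̄_p)^× × ℂ^×` are CM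
  periods over `L` as in [JSW, §4.5]." — data of `(L, p, v, ι_p, ι_∞)` ONLY, no newform in sight; and
  the normalisation (label `nrm`, l.3677–3680, after Thm. 4.22): "`𝓗_v = (h_L/w_L) · T_v · 𝓛_v(L) ∈ Λ_L^{v,ur}`,
  so that `(H_v) = (𝓗_v)`" (`H_v` a congruence power series of the canonical CM family `𝐡_v`).
* §6 preamble (l.4870–4871): "We continue with the notation and conventions introduced in §§2–4.
  Throughout this section we assume the newform `g ∈ S₂(Γ₀(N))` to be supersingular at `p`." — §6.4
  (l.5516–5520, l.5539–5542): "`𝓛^int_∘ = 𝓗_v · 𝓛_∘ : H¹_∘(ℚ_p, T(1) ⊗̂ ℍ̃⁻ ⊗̂ Λ) ⊗ Λ^v_{L,𝒪_λ^ur} → 𝓡^ur`",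
  "`𝓛_p^Gr(g/L) = 𝓛^int_∘(loc_p(𝓑𝓕^∘(g/L))) ∈ 𝓡^ur`" — Thm. 6.17 (label `ERLIIint-thm-ss`, l.5565–5581,
  quoted in the module docstring) followed by (l.5583) "Here `(Ω_p, Ω_∞)` are the CM periods as in
  Theorem 4.19".

So the printed logical form is: ONE Katz function `𝓛_v(L)` with ITS period pair for the field data, THEN,
for EVERY newform `g` of §6 (weight 2, trivial character, level `N` with (IQF): `p = v v̄` split and `N_L`
square-free; `a_g(p) = 0`), the integral `𝓛_p^Gr(g/L) = 𝓗_v · 𝓛_∘(loc_p 𝓑𝓕^∘(g/L))` normalised against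
THAT `𝓛_v(L)` — «∃ frame, ∀ g, ∃ G» (∃∀). The §1 binder has the per-newform order «∀ g, ∃ (frame, G)»
(∀∃): implied by (∃∀) — PROVED below, `…_supersingular_PRE_of_commonKatzFrame` — but it does not let a
consumer place the Greenberg functions `G`, `G′` of TWO newforms (an elliptic newform and the newform of
a quadratic twist, route `SignedBaseChange`, items K1 / K2R) over one common Katz series `LK`, which is
how the kernel `thm924_…_OPEN` (sibling file) and the K1 package quantify them; two applications of §1
yield two frames that no tree lemma identifies (two Katz frames differ by a unit of `𝒪_{ℂ_p}⟦T₁,T₂⟧`, a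
rigidity that is neither printed nor in the tree). The binder of this section is the (∃∀) form in the
same currency, with the same transcription, READING FLAGS and WEAKER points as §1 (its Lean text is the
requesting planner's `CommonFrameShape`, cell `pub/bsd-wall`, `bsd-wall-ss/Sketch4.lean`, sha16
79d9a77aeedcd5c3); its frame conjunct alone is refereed (de Shalit 1987, II.4.17 — tree fact
`DeShalit1987.thmII417_exists_katzSheet`), only the `∀ g ∃ G` clause is the PREPRINT claim. ONE new
binder (claim-tagged, never a fact, no `_holds`); three bookkeeping theorems PROVED. -/

section CommonFrame

/-- **OPEN HYPOTHESIS — UNREFEREED PREPRINT (arXiv:2409.01350v2), Thm. 4.19 (Katz, label `pKatzL`) + §6.4 +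
Thm. 6.17 (Explicit Reciprocity Law II′, supersingular case) in PRINT'S QUANTIFIER ORDER, for elliptic
curves: for the field data — a prime `p ≥ 5`, `K` imaginary quadratic with `p = v v̄` split (`v` induced
by `ι`), the cyclotomic / anticyclotomic `ℤ_p²`-tower `(κ₁, κ₂)` with a generator pair `(γ₁, γ₂)` — there
is ONE Katz frame, i.e. period data `(Ω ≠ 0, δ² = ±D_K, Ω_p ∈ (ℤ_p^ur)ˣ)` and a series `LK` with
`IsKatzMeasure₂ ι v v̄ ∅ κ₁ κ₂ γ₁⁻¹ γ₂⁻¹ 1 Ω δ Ω_p LK` ("there exists an unique `𝓛_v(L) ∈ Λ_L^{v,ur}` …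
`(Ω_p, Ω_∞)` CM periods over `L` as in [JSW, §4.5]", Thm. 4.19), over which EVERY newform `f = f_E` of a
globally minimal `E/ℚ` of conductor `N` with `p ∤ N`, `a_p(E) = 0` and `(N, D_K) = 1` has an integral
two-variable Greenberg `p`-adic `L`-function: a series `G ∈ 𝒪_{ℂ_p}⟦T₁⟧⟦T₂⟧` with
`IsGreenbergLFunctionAnyRoot₂ ι v v̄ κ₁ κ₂ γ₁⁻¹ γ₂⁻¹ f |D_K| h_K LK G`** ("Throughout this section we assume
the newform `g` … to be supersingular at `p`"; "`𝓛_p^Gr(g/L) = 𝓛^int_∘(loc_p(𝓑𝓕^∘(g/L))) ∈ 𝓡^ur`" with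
`𝓛^int_∘ = 𝓗_v · 𝓛_∘`, `𝓗_v = (h_L/w_L) · T_v · 𝓛_v(L)`; Thm. 6.17: "Here `(Ω_p, Ω_∞)` are the CM periods
as in Theorem 4.19"). Binder atoms and conclusion atoms VERBATIM those of §1
(`thm617_exists_isGreenbergLFunctionAnyRoot₂_supersingular_PRE`); only the quantifier order differs
(field data, `∃` frame, `∀` newform, `∃ G`), and (∃∀) ⇒ §1 is `…_supersingular_PRE_of_commonKatzFrame`
below. WEAKER than print exactly where §1 is (`p ≥ 5` for "`p` odd"; `G ∈ 𝒪_{ℂ_p}⟦T₁,T₂⟧` for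
`Λ_{L,𝒪_λ^ur}`; "some" Katz frame of the tree's de Shalit currency for "the" frame of [JSW, §4.5]);
READING FLAGS of §1 and of the sibling `thm924_…_OPEN` inherited (`BSTW-924-conjugate-convention`; the
YZ/CGS ↔ BSTW normalisation `(L_p^Gr)_{CGS} = (c_*𝓛_p^Gr)_{BSTW}` is cell-refereed, NOT in print) — hence
claim-tagged twice over; the frame conjunct alone is refereed (de Shalit II.4.17,
`DeShalit1987.thmII417_exists_katzSheet`). NEVER cite this `Prop` as a theorem.
[claim: BurungaleSkinnerTianWan2024, status: under-review]
[cite: BurungaleSkinnerTianWan2024, Thm. 4.19 (pKatzL, TeX l.3606–3618) with (nrm) (l.3677–3680), §6 preamble (l.4870–4871), §6.4 (l.5504–5542; 𝓛_p^Gr(g/L) ∈ 𝓡^ur at l.5541) and Thm. 6.17 (ERLIIint-thm-ss, l.5565–5583); §6.6.1 (two-variable-zeta-ss, l.5754–5829) (ANNOUNCED, OPEN binder)] -/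
def thm617_exists_commonKatzFrame_isGreenbergLFunctionAnyRoot₂_supersingular_PRE : Prop :=
  ∀ {p : ℕ} [Fact p.Prime] (ι : PadicAlgCl p ≃+* ℂ) (K : Type) [Field K] [NumberField K]
    (v vbar : HeightOneSpectrum (𝓞 K)) (κ₁ κ₂ : ZpExtension K p) (γ₁ γ₂ : absoluteGaloisGroup K)
    [Fact (ZpExtension.IsTopGeneratorPair κ₁ κ₂ γ₁ γ₂)] [NeZero (NumberField.discr K).natAbs],
    -- field data: `p ≥ 5`; `L = K` imaginary quadratic; (h2) `p = v v̄` split, `v` induced by `ι`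
    5 ≤ p → IsImaginaryQuadratic K → ((Ideal.span {(p : ℤ)}).primesOver (𝓞 K)).ncard = 2 →
    ((p : ℕ) : 𝓞 K) ∈ v.asIdeal → ((p : ℕ) : 𝓞 K) ∈ vbar.asIdeal → vbar ≠ v →
    (∀ (w : InfinitePlace K) (k : 𝓞 K), k ∈ v.asIdeal ↔ ‖ι.symm (w.embedding (k : K))‖ < 1) →
    -- the `ℤ_p²`-tower: `κ₁` cyclotomic, `κ₂` anticyclotomic, generator pair `(γ₁, γ₂)`
    κ₁.IsCyclotomic → κ₂.IsAnticyclotomic →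
    -- ONE Katz frame for the field data (Thm. 4.19: `𝓛_v(L)` with its CM period pair) …
    ∃ (Ω δ : ℂ) (Ωp : (unrIntegers p)ˣ) (LK : PowerSeries (PowerSeries (PadicComplexInt p))),
      Ω ≠ 0 ∧ (δ ^ 2 = (NumberField.discr K : ℂ) ∨ δ ^ 2 = -(NumberField.discr K : ℂ)) ∧
      IsKatzMeasure₂ ι v vbar ∅ κ₁ κ₂ γ₁⁻¹ γ₂⁻¹ 1 Ω δ ((Ωp : unrIntegers p) : ℂ_[p]) LK ∧
      -- … over which EVERY newform `g = f_E` supersingular at `p` (`p ∤ N_E`, `a_p(E) = 0`) with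
      -- (h1) `(N_E, D_K) = 1` has its `G = 𝓛_p^Gr(g/L)` (§6.4, Thm. 6.17)
      ∀ (W : WeierstrassCurve ℚ) [W.IsElliptic] [W.IsGloballyMinimal] {N : ℕ} [NeZero N]
        {f : CuspForm (Gamma0 N) 2} (_ : IsNewformOf W f),
        (N : ℤ) = W.conductorNorm ℤ → ¬ (p : ℤ) ∣ W.conductorNorm ℤ → W.frobeniusTrace p = 0 →
        IsCoprime (N : ℤ) (NumberField.discr K) →
        ∃ G : PowerSeries (PowerSeries (PadicComplexInt p)),
          IsGreenbergLFunctionAnyRoot₂ ι v vbar κ₁ κ₂ γ₁⁻¹ γ₂⁻¹ f (NumberField.discr K).natAbs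
            (NumberField.classNumber K) LK G

/-- (∃∀) ⇒ (∀∃): the common-frame binder implies the per-newform binder of §1 (the requesting
planner's `landed_of_commonFrameShape`). Pure logic; asserts nothing about curves.
[cite: BurungaleSkinnerTianWan2024, §6.4 with Thm. 4.19 (TeX l.5539–5542, l.3606–3618) (shape only; nothing asserted)] -/
theorem thm617_exists_isGreenbergLFunctionAnyRoot₂_supersingular_PRE_of_commonKatzFrame
    (h : thm617_exists_commonKatzFrame_isGreenbergLFunctionAnyRoot₂_supersingular_PRE) :
    thm617_exists_isGreenbergLFunctionAnyRoot₂_supersingular_PRE := by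
  intro p _ ι W _ _ K _ _ v vbar κ₁ κ₂ γ₁ γ₂ _ N _ f hf _ hN hp5 hpN hap hK hsplit hv hvbar hne hι hcop
    hcyc hanti
  obtain ⟨Ω, δ, Ωp, LK, hΩ, hδ, hLK, hall⟩ :=
    h ι K v vbar κ₁ κ₂ γ₁ γ₂ hp5 hK hsplit hv hvbar hne hι hcyc hanti
  obtain ⟨G, hG⟩ := hall W hf hN hpN hap hcop
  exact ⟨Ω, δ, Ωp, LK, G, hΩ, hδ, hLK, hG⟩

/-- The frame conjunct of the common-frame binder: under the field data a Katz frame exists (this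
conjunct alone is de Shalit II.4.17, tree fact `DeShalit1987.thmII417_exists_katzSheet`; conjunct (a) of
the consumer `GreenbergFramesAtSupersingular`). Pure logic; asserts nothing about curves.
[cite: BurungaleSkinnerTianWan2024, Thm. 4.19 (pKatzL, TeX l.3606–3618) (shape only; nothing asserted)] -/
theorem exists_katzFrame_of_commonKatzFrame
    (h : thm617_exists_commonKatzFrame_isGreenbergLFunctionAnyRoot₂_supersingular_PRE)
    {p : ℕ} [Fact p.Prime] (ι : PadicAlgCl p ≃+* ℂ) (K : Type) [Field K] [NumberField K]
    (v vbar : HeightOneSpectrum (𝓞 K)) (κ₁ κ₂ : ZpExtension K p) (γ₁ γ₂ : absoluteGaloisGroup K)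
    [Fact (ZpExtension.IsTopGeneratorPair κ₁ κ₂ γ₁ γ₂)] [NeZero (NumberField.discr K).natAbs]
    (hp : 5 ≤ p) (hK : IsImaginaryQuadratic K)
    (hsplit : ((Ideal.span {(p : ℤ)}).primesOver (𝓞 K)).ncard = 2)
    (hv : ((p : ℕ) : 𝓞 K) ∈ v.asIdeal) (hvbar : ((p : ℕ) : 𝓞 K) ∈ vbar.asIdeal) (hne : vbar ≠ v)
    (hι : ∀ (w : InfinitePlace K) (k : 𝓞 K), k ∈ v.asIdeal ↔ ‖ι.symm (w.embedding (k : K))‖ < 1)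
    (hcyc : κ₁.IsCyclotomic) (hanti : κ₂.IsAnticyclotomic) :
    ∃ (Ω δ : ℂ) (Ωp : (unrIntegers p)ˣ) (LK : PowerSeries (PowerSeries (PadicComplexInt p))),
      Ω ≠ 0 ∧ (δ ^ 2 = (NumberField.discr K : ℂ) ∨ δ ^ 2 = -(NumberField.discr K : ℂ)) ∧
      IsKatzMeasure₂ ι v vbar ∅ κ₁ κ₂ γ₁⁻¹ γ₂⁻¹ 1 Ω δ ((Ωp : unrIntegers p) : ℂ_[p]) LK := by
  obtain ⟨Ω, δ, Ωp, LK, hΩ, hδ, hLK, -⟩ :=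
    h ι K v vbar κ₁ κ₂ γ₁ γ₂ hp hK hsplit hv hvbar hne hι hcyc hanti
  exact ⟨Ω, δ, Ωp, LK, hΩ, hδ, hLK⟩

/-- **The tuple a two-newform consumer needs** (route `SignedBaseChange`, items K1 / K2R′: the newform
`f` of `E` and the newform `f′` of a quadratic twist `E′`, both supersingular at `p`, both of level
prime to `D_K`): from the common-frame binder, ONE Katz frame `(Ω, δ, Ω_p, LK)` carrying a Greenberg
series `G` for `f` AND a Greenberg series `G′` for `f′`. Pure logic; asserts nothing about curves.
[cite: BurungaleSkinnerTianWan2024, §6.4 with Thm. 4.19 (TeX l.5539–5542, l.3606–3618) (shape only; nothing asserted)] -/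
theorem exists_commonKatzFrame_greenberg_pair
    (h : thm617_exists_commonKatzFrame_isGreenbergLFunctionAnyRoot₂_supersingular_PRE)
    {p : ℕ} [Fact p.Prime] (ι : PadicAlgCl p ≃+* ℂ) (K : Type) [Field K] [NumberField K]
    (v vbar : HeightOneSpectrum (𝓞 K)) (κ₁ κ₂ : ZpExtension K p) (γ₁ γ₂ : absoluteGaloisGroup K)
    [Fact (ZpExtension.IsTopGeneratorPair κ₁ κ₂ γ₁ γ₂)] [NeZero (NumberField.discr K).natAbs]
    (hp : 5 ≤ p) (hK : IsImaginaryQuadratic K)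
    (hsplit : ((Ideal.span {(p : ℤ)}).primesOver (𝓞 K)).ncard = 2)
    (hv : ((p : ℕ) : 𝓞 K) ∈ v.asIdeal) (hvbar : ((p : ℕ) : 𝓞 K) ∈ vbar.asIdeal) (hne : vbar ≠ v)
    (hι : ∀ (w : InfinitePlace K) (k : 𝓞 K), k ∈ v.asIdeal ↔ ‖ι.symm (w.embedding (k : K))‖ < 1)
    (hcyc : κ₁.IsCyclotomic) (hanti : κ₂.IsAnticyclotomic)
    (W W' : WeierstrassCurve ℚ) [W.IsElliptic] [W.IsGloballyMinimal] [W'.IsElliptic]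
    [W'.IsGloballyMinimal] {N N' : ℕ} [NeZero N] [NeZero N'] {f : CuspForm (Gamma0 N) 2}
    {f' : CuspForm (Gamma0 N') 2} (hf : IsNewformOf W f) (hf' : IsNewformOf W' f')
    (hN : (N : ℤ) = W.conductorNorm ℤ) (hpN : ¬ (p : ℤ) ∣ W.conductorNorm ℤ)
    (hap : W.frobeniusTrace p = 0) (hcop : IsCoprime (N : ℤ) (NumberField.discr K))
    (hN' : (N' : ℤ) = W'.conductorNorm ℤ) (hpN' : ¬ (p : ℤ) ∣ W'.conductorNorm ℤ)
    (hap' : W'.frobeniusTrace p = 0) (hcop' : IsCoprime (N' : ℤ) (NumberField.discr K)) :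
    ∃ (Ω δ : ℂ) (Ωp : (unrIntegers p)ˣ) (LK G G' : PowerSeries (PowerSeries (PadicComplexInt p))),
      Ω ≠ 0 ∧ (δ ^ 2 = (NumberField.discr K : ℂ) ∨ δ ^ 2 = -(NumberField.discr K : ℂ)) ∧
      IsKatzMeasure₂ ι v vbar ∅ κ₁ κ₂ γ₁⁻¹ γ₂⁻¹ 1 Ω δ ((Ωp : unrIntegers p) : ℂ_[p]) LK ∧
      IsGreenbergLFunctionAnyRoot₂ ι v vbar κ₁ κ₂ γ₁⁻¹ γ₂⁻¹ f (NumberField.discr K).natAbs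
        (NumberField.classNumber K) LK G ∧
      IsGreenbergLFunctionAnyRoot₂ ι v vbar κ₁ κ₂ γ₁⁻¹ γ₂⁻¹ f' (NumberField.discr K).natAbs
        (NumberField.classNumber K) LK G' := by
  obtain ⟨Ω, δ, Ωp, LK, hΩ, hδ, hLK, hall⟩ :=
    h ι K v vbar κ₁ κ₂ γ₁ γ₂ hp hK hsplit hv hvbar hne hι hcyc hanti
  obtain ⟨G, hG⟩ := hall W hf hN hpN hap hcop
  obtain ⟨G', hG'⟩ := hall W' hf' hN' hpN' hap' hcop'
  exact ⟨Ω, δ, Ωp, LK, G, G', hΩ, hδ, hLK, hG, hG'⟩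

end CommonFrame

/-! ### §3. Print's prime range «`p` odd» — the common-frame binder of §2 with `5 ≤ p ↦ p ≠ 2` (appended 2026-08-29 by the
ARM-P typing seat `bsd-armP-typer-19000-BSTW617` of the cell `pub/bsd-ssimc`, at the request of director-bsd for the LEAD of crux
`stmt-BirchSwinnertonDyer-19000` (line «defmu», skeleton v6 stub `stub_bstw617OddPrime` = hypothesis `h617odd` of
`Summit.….Theorems.SemistableDefmuOddPrime.threeResidual_of_citePacks`); §1, §2 and their projections above are untouched)

PRINTED RANGE (arXiv:2409.01350v2, v2 TeX `main.tex` ABSOLUTE line numbers as in §2; printed numbers from the concordance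
`pub/bsd-littype/staging/bsd-littype-01/numbering.tsv`; store chunks `paper:arxiv-2409.01350` [pNNNN] re-read this session):

* §2.1.1 "The prime `p`" (l.1074–1076; [p0012 L12–14]): "Throughout `p ≥ 3` will be an odd prime. Some results will also hold
  even for `p = 2`, but restricting to odd `p` simplifies many arguments. Some of the main results of this paper are only
  stated for `p ≥ 5`. When appropriate we include commments on this restriction."
* §2.2.11 "The supersingular case" (l.1505; [p0016 L19–22]): "This is the case where `p ∤ N` and `a_g(p) = 0` … In this case
  we say that `g` is supersingular", footnote: "If `g` is associated with an elliptic curve, then `p ∤ 2N` being a prime of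
  supersingular reduction need not imply `a_g(p) = 0` (but only when `p = 3`). However, we adopt the terminology for convenience."
* §1.2.1 (h4) (l.673–677): "In the supersingular case we assume (h4) `a_p(E) := p + 1 − #E(𝔽_p) = 0`, referring to `p` as
  supersingular. This is automatic for `p ≥ 5`." — Conj. 1.2 (label `Kob`, l.429): "`p ∤ 2N` a supersingular prime. If
  `p = 3`, suppose that (h4) holds"; Thm. 1.3 (`thmA`, l.439): "`E` semistable, and `p > 2` a supersingular prime. If `p = 3`,
  suppose that (h4) holds"; Thm. 1.14 (`thmZ`, l.712): "`p ∤ 2N` a prime. In the case `p = 3` suppose that (h4) holds if `p`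
  is supersingular."
* §6 (label `BFss`, l.4856 ff.) — the section of Thm. 6.17 (`ERLIIint-thm-ss`, l.5565–5583, quoted in the module
  docstring) — carries NO `p ≥ 5`: its only range words are Remark 6.1 (below) and §6.4 (l.5528) "As `p` is odd, we can
  therefore choose `c` so that `𝐜 ∈ 𝓡^×`." So Thm. 6.17 is PRINTED for every odd prime `p ∤ N` with `a_g(p) = 0` — `p = 3`
  with (h4) included; the `5 ≤ p` of §1/§2 was the tree's convenience restriction (their docstrings: "WEAKER than print
  exactly where … `p ≥ 5` for '`p` odd'").

READING FLAG «BSTW-p3-via-Cais» (what print itself says its `p = 3` coverage rests on — recorded, not adjudicated):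
(a) after Thm. 4.1 (label `ordTate`, Ohta's structure theorem for the ordinary `Λ`-adic étale cohomology; l.2915, [p0029 L7]):
"For `p ≥ 5`, this theorem is explained in [FK, §§1.7–1.8]. It is also proved in [Oh1, Oh2] (but see the remarks in [FK,
§§1.7.15–16]). See also [KLZ, Thm. 7.2.3]. The arguments in these papers likely apply to the `p = 3` case as well. The results
of [Ca] explicitly covers some parts of the `p = 3` cases. An alternate proof that also includes the `p = 3` case is included
in [SV-S-Ohta]."; (b) Remark 6.1 (l.4918–4922, [p0049 L53–55]): "In [LLZa], [KLZ], [LZ], [BL] it is assumed that `p > 3`.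
For odd primes `p`, the hypothesis arises only when considering explicit reciprocity laws, being due to its occurrence in the
work of Ohta [Oh1], [Oh2] on `p`-adic Eichler–Shimura isomorphism. Since the central character of the canonical CM Hida family
`𝐡_v` is non-trivial, the pertinent Eichler–Shimura isomorphism is proved in [SV-S-Ohta] (with many cases already covered in
Cais [Ca]) for `p ≥ 3`, and so the explicit reciprocity laws hold in our setting for any odd prime `p`." Here [Ca] = B. Cais,
Compos. Math. 154 (2018) 719–760 (refereed) and [SV-S-Ohta] = M. Sangiovanni Vincentelli–C. Skinner, "A generalization of
Ohta's theorem for holomorphic automorphic forms", PREPRINT (bibliography l.8699). So AT `p = 3` the printed claim leans on a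
further unrefereed preprint beyond arXiv:2409.01350 itself (partly on the refereed [Ca]); the cell's referee memo
`pub/bsd-ssimc/bstw-MEMO-10` locates the same residual ("(3-ii)♭′ + B1"). This is WHY the odd-prime binder is a separate name:
a consumer at `5 ≤ p` keeps citing §2/§1, whose trust base does not include [SV-S-Ohta].

TRANSCRIPTION: the Lean text of §2's `thm617_exists_commonKatzFrame_isGreenbergLFunctionAnyRoot₂_supersingular_PRE` VERBATIM with
the single binder change `5 ≤ p ↦ p ≠ 2` (`W.frobeniusTrace p = 0` KEPT — it is (h4) at `p = 3` and §2.2.11's `a_g(p) = 0` at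
every `p`); same currency, same READING FLAGS (`BSTW-924-conjugate-convention`; `(L_p^Gr)_{CGS} = (c_*𝓛_p^Gr)_{BSTW}` cell-refereed,
not in print), same WEAKER points minus the prime range. (h3) `E[p](K) = 0` stays a non-binder at every odd supersingular `p`
with `a_p = 0` split in `K`: `E(K_v) = E(ℚ_p)`, `#Ẽ(𝔽_p) = p + 1` is prime to `p`, and `Ê(pℤ_p)` has no `p`-torsion for
`p > 2` (a torsion point of order `p` has valuation `≤ v(p)/(p − 1) < 1`); Remark 1.15 (i) calls (h3) inessential anyway.
ONE new binder (claim-tagged, NEVER a fact, no `_holds`); FOUR bookkeeping theorems PROVED (pure logic): odd ⇒ §2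
(`…_supersingular_PRE_of_odd`, since `5 ≤ p ⇒ p ≠ 2` — so §2 and §1 are NOT restated), odd ⇒ the per-newform odd-prime shape
(= the LEAD's `stub_bstw617OddPrime` / `h617odd` VERBATIM), odd ⇒ §1, and the frame conjunct at odd `p`. -/

section OddPrime

/-- **OPEN HYPOTHESIS — UNREFEREED PREPRINT (arXiv:2409.01350v2), Thm. 4.19 (Katz, label `pKatzL`) + §6.4 + Thm. 6.17
(Explicit Reciprocity Law II′, supersingular case) with §1.2.1 (h4), in PRINT'S QUANTIFIER ORDER and at PRINT'S PRIME RANGE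
«`p` odd» (§2.1.1 "Throughout `p ≥ 3` will be an odd prime"; (h4) "`a_p(E) = 0` … automatic for `p ≥ 5`"; Conj. 1.2 /
Thm. 1.3 / Thm. 1.14: "`p ∤ 2N` … if `p = 3`, suppose that (h4) holds"), for elliptic curves: for the field data — an ODD
prime `p`, `K` imaginary quadratic with `p = v v̄` split (`v` induced by `ι`), the cyclotomic / anticyclotomic `ℤ_p²`-tower
`(κ₁, κ₂)` with a generator pair `(γ₁, γ₂)` — there is ONE Katz frame, i.e. period data `(Ω ≠ 0, δ² = ±D_K, Ω_p ∈ (ℤ_p^ur)ˣ)`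
and a series `LK` with `IsKatzMeasure₂ ι v v̄ ∅ κ₁ κ₂ γ₁⁻¹ γ₂⁻¹ 1 Ω δ Ω_p LK` (Thm. 4.19), over which EVERY newform `f = f_E`
of a globally minimal `E/ℚ` of conductor `N` with `p ∤ N`, `a_p(E) = 0` ((h4); §2.2.11 "supersingular") and `(N, D_K) = 1`
has an integral two-variable Greenberg `p`-adic `L`-function: a series `G ∈ 𝒪_{ℂ_p}⟦T₁⟧⟦T₂⟧` with
`IsGreenbergLFunctionAnyRoot₂ ι v v̄ κ₁ κ₂ γ₁⁻¹ γ₂⁻¹ f |D_K| h_K LK G`** ("`𝓛_p^Gr(g/L) = 𝓛^int_∘(loc_p(𝓑𝓕^∘(g/L))) ∈ 𝓡^ur`",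
§6.4; "Here `(Ω_p, Ω_∞)` are the CM periods as in Theorem 4.19", Thm. 6.17). The Lean text of §2's
`thm617_exists_commonKatzFrame_isGreenbergLFunctionAnyRoot₂_supersingular_PRE` VERBATIM with the single change `5 ≤ p ↦ p ≠ 2`
(print's range; §2/§1 follow from this binder, `…_supersingular_PRE_of_odd` below — nothing is restated); same currency,
WEAKER points (`G ∈ 𝒪_{ℂ_p}⟦T₁,T₂⟧` for `Λ_{L,𝒪_λ^ur}`; "some" Katz frame of the de Shalit currency for "the" frame of
[JSW, §4.5]) and READING FLAGS (`BSTW-924-conjugate-convention`; `(L_p^Gr)_{CGS} = (c_*𝓛_p^Gr)_{BSTW}` cell-refereed, NOT in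
print) as §2, PLUS the reading flag «BSTW-p3-via-Cais»: AT `p = 3` print's coverage rests on its remark after Thm. 4.1
(TeX l.2915: for `p ≥ 5` [FK]/[Oh1, Oh2]; "likely apply to the `p = 3` case as well"; "[Ca] explicitly covers some parts";
"an alternate proof that also includes the `p = 3` case is included in [SV-S-Ohta]") and on Remark 6.1 (l.4918–4922: the
`p > 3` of [LLZa, KLZ, LZ, BL] "arises only when considering explicit reciprocity laws … proved in [SV-S-Ohta] (with many
cases already covered in Cais [Ca]) for `p ≥ 3`, and so the explicit reciprocity laws hold in our setting for any odd prime
`p`"), [SV-S-Ohta] being itself a PREPRINT — hence claim-tagged thrice over at `p = 3`; the frame conjunct alone is refereed at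
every `p` (de Shalit II.4.17, `DeShalit1987.thmII417_exists_katzSheet`). NEVER cite this `Prop` as a theorem.
[claim: BurungaleSkinnerTianWan2024, status: under-review]
[cite: BurungaleSkinnerTianWan2024, Thm. 6.17 (ERLIIint-thm-ss, TeX l.5565–5583) with Thm. 4.19 (pKatzL, l.3606–3618), §6.4 (l.5504–5542), §6.6.1 (two-variable-zeta-ss, l.5754–5829); range: §2.1.1 (l.1074–1076), §2.2.11 (l.1505), §1.2.1 (h4) (l.673–677), Rem. 6.1 (l.4918–4922), remark after Thm. 4.1 (l.2915) (ANNOUNCED, OPEN binder)] -/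
def thm617_exists_commonKatzFrame_isGreenbergLFunctionAnyRoot₂_supersingular_odd_PRE : Prop :=
  ∀ {p : ℕ} [Fact p.Prime] (ι : PadicAlgCl p ≃+* ℂ) (K : Type) [Field K] [NumberField K]
    (v vbar : HeightOneSpectrum (𝓞 K)) (κ₁ κ₂ : ZpExtension K p) (γ₁ γ₂ : absoluteGaloisGroup K)
    [Fact (ZpExtension.IsTopGeneratorPair κ₁ κ₂ γ₁ γ₂)] [NeZero (NumberField.discr K).natAbs],
    -- field data: `p` ODD (print: "`p ≥ 3` … an odd prime"); `L = K` imaginary quadratic; (h2) `p = v v̄` split,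
    -- `v` induced by `ι`
    p ≠ 2 → IsImaginaryQuadratic K → ((Ideal.span {(p : ℤ)}).primesOver (𝓞 K)).ncard = 2 →
    ((p : ℕ) : 𝓞 K) ∈ v.asIdeal → ((p : ℕ) : 𝓞 K) ∈ vbar.asIdeal → vbar ≠ v →
    (∀ (w : InfinitePlace K) (k : 𝓞 K), k ∈ v.asIdeal ↔ ‖ι.symm (w.embedding (k : K))‖ < 1) →
    -- the `ℤ_p²`-tower: `κ₁` cyclotomic, `κ₂` anticyclotomic, generator pair `(γ₁, γ₂)`
    κ₁.IsCyclotomic → κ₂.IsAnticyclotomic →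
    -- ONE Katz frame for the field data (Thm. 4.19: `𝓛_v(L)` with its CM period pair) …
    ∃ (Ω δ : ℂ) (Ωp : (unrIntegers p)ˣ) (LK : PowerSeries (PowerSeries (PadicComplexInt p))),
      Ω ≠ 0 ∧ (δ ^ 2 = (NumberField.discr K : ℂ) ∨ δ ^ 2 = -(NumberField.discr K : ℂ)) ∧
      IsKatzMeasure₂ ι v vbar ∅ κ₁ κ₂ γ₁⁻¹ γ₂⁻¹ 1 Ω δ ((Ωp : unrIntegers p) : ℂ_[p]) LK ∧
      -- … over which EVERY newform `g = f_E` supersingular at `p` (`p ∤ N_E`, (h4) `a_p(E) = 0`) with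
      -- (h1) `(N_E, D_K) = 1` has its `G = 𝓛_p^Gr(g/L)` (§6.4, Thm. 6.17)
      ∀ (W : WeierstrassCurve ℚ) [W.IsElliptic] [W.IsGloballyMinimal] {N : ℕ} [NeZero N]
        {f : CuspForm (Gamma0 N) 2} (_ : IsNewformOf W f),
        (N : ℤ) = W.conductorNorm ℤ → ¬ (p : ℤ) ∣ W.conductorNorm ℤ → W.frobeniusTrace p = 0 →
        IsCoprime (N : ℤ) (NumberField.discr K) →
        ∃ G : PowerSeries (PowerSeries (PadicComplexInt p)),
          IsGreenbergLFunctionAnyRoot₂ ι v vbar κ₁ κ₂ γ₁⁻¹ γ₂⁻¹ f (NumberField.discr K).natAbs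
            (NumberField.classNumber K) LK G

/-- odd ⇒ `5 ≤ p`: the odd-prime binder implies §2's common-frame binder (`5 ≤ p → p ≠ 2`), so §2 is a COROLLARY of
§3 and not a second claim. Pure logic; asserts nothing about curves.
[cite: BurungaleSkinnerTianWan2024, §2.1.1 (TeX l.1074–1076) with Thm. 6.17 (l.5565–5583) (shape only; nothing asserted)] -/
theorem thm617_exists_commonKatzFrame_isGreenbergLFunctionAnyRoot₂_supersingular_PRE_of_odd
    (h : thm617_exists_commonKatzFrame_isGreenbergLFunctionAnyRoot₂_supersingular_odd_PRE) :
    thm617_exists_commonKatzFrame_isGreenbergLFunctionAnyRoot₂_supersingular_PRE := by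
  intro p _ ι K _ _ v vbar κ₁ κ₂ γ₁ γ₂ _ _ hp5 hK hsplit hv hvbar hne hι hcyc hanti
  exact h ι K v vbar κ₁ κ₂ γ₁ γ₂ (by omega) hK hsplit hv hvbar hne hι hcyc hanti

/-- odd ⇒ §1 (per newform, `5 ≤ p`), through §2. Pure logic; asserts nothing about curves.
[cite: BurungaleSkinnerTianWan2024, §6.4 with Thm. 4.19 (TeX l.5539–5542, l.3606–3618) (shape only; nothing asserted)] -/
theorem thm617_exists_isGreenbergLFunctionAnyRoot₂_supersingular_PRE_of_commonKatzFrame_odd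
    (h : thm617_exists_commonKatzFrame_isGreenbergLFunctionAnyRoot₂_supersingular_odd_PRE) :
    thm617_exists_isGreenbergLFunctionAnyRoot₂_supersingular_PRE :=
  thm617_exists_isGreenbergLFunctionAnyRoot₂_supersingular_PRE_of_commonKatzFrame
    (thm617_exists_commonKatzFrame_isGreenbergLFunctionAnyRoot₂_supersingular_PRE_of_odd h)

/-- **(∃∀) ⇒ (∀∃) at an odd prime — the consumer's shape.** From the odd-prime common-frame binder: the PER-NEWFORM
odd-prime statement, i.e. the Lean text of §1's `thm617_exists_isGreenbergLFunctionAnyRoot₂_supersingular_PRE` with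
`5 ≤ p ↦ p ≠ 2` — VERBATIM the registered typing stub `stub_bstw617OddPrime` of crux `stmt-BirchSwinnertonDyer-19000`
(line «defmu», skeleton v6) and the displayed hypothesis `h617odd` of
`Summit.BirchSwinnertonDyer.BirchSwinnertonDyer.Theorems.SemistableDefmuOddPrime.threeResidual_of_citePacks`, so that
consumer is fed `(this h)`. Pure logic; asserts nothing about curves; the conclusion is an OPEN preprint claim exactly as
much as `h` is. [cite: BurungaleSkinnerTianWan2024, §6.4 with Thm. 4.19 and Thm. 6.17 (TeX l.5539–5542, l.3606–3618, l.5565–5583) (shape only; nothing asserted)] -/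
theorem thm617_exists_isGreenbergLFunctionAnyRoot₂_supersingular_odd_of_commonKatzFrame_odd
    (h : thm617_exists_commonKatzFrame_isGreenbergLFunctionAnyRoot₂_supersingular_odd_PRE) :
    ∀ {p : ℕ} [Fact p.Prime] (ι : PadicAlgCl p ≃+* ℂ) (W : WeierstrassCurve ℚ) [W.IsElliptic]
      [W.IsGloballyMinimal] (K : Type) [Field K] [NumberField K] (v vbar : HeightOneSpectrum (𝓞 K))
      (κ₁ κ₂ : ZpExtension K p) (γ₁ γ₂ : absoluteGaloisGroup K)
      [Fact (ZpExtension.IsTopGeneratorPair κ₁ κ₂ γ₁ γ₂)] {N : ℕ} [NeZero N] {f : CuspForm (Gamma0 N) 2}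
      (_ : IsNewformOf W f) [NeZero (NumberField.discr K).natAbs],
      -- `g = f_E` of level `N = N_E`; `p` ODD of good SUPERSINGULAR reduction: `p ∤ N_E`, `a_p(E) = 0`
      (N : ℤ) = W.conductorNorm ℤ → p ≠ 2 → ¬ (p : ℤ) ∣ W.conductorNorm ℤ → W.frobeniusTrace p = 0 →
      -- `L = K` imaginary quadratic; (h2) `p = v v̄` split, `v` induced by `ι`; (h1) `(N, D_K) = 1`
      IsImaginaryQuadratic K → ((Ideal.span {(p : ℤ)}).primesOver (𝓞 K)).ncard = 2 →
      ((p : ℕ) : 𝓞 K) ∈ v.asIdeal → ((p : ℕ) : 𝓞 K) ∈ vbar.asIdeal → vbar ≠ v →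
      (∀ (w : InfinitePlace K) (k : 𝓞 K), k ∈ v.asIdeal ↔ ‖ι.symm (w.embedding (k : K))‖ < 1) →
      IsCoprime (N : ℤ) (NumberField.discr K) →
      -- the `ℤ_p²`-tower: `κ₁` cyclotomic, `κ₂` anticyclotomic, generator pair `(γ₁, γ₂)`
      κ₁.IsCyclotomic → κ₂.IsAnticyclotomic →
      -- a Katz frame (period data + Katz's two-variable measure) and `G = 𝓛_p^Gr(f/K)` in it
      ∃ (Ω δ : ℂ) (Ωp : (unrIntegers p)ˣ) (LK G : PowerSeries (PowerSeries (PadicComplexInt p))),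
        Ω ≠ 0 ∧ (δ ^ 2 = (NumberField.discr K : ℂ) ∨ δ ^ 2 = -(NumberField.discr K : ℂ)) ∧
        IsKatzMeasure₂ ι v vbar ∅ κ₁ κ₂ γ₁⁻¹ γ₂⁻¹ 1 Ω δ ((Ωp : unrIntegers p) : ℂ_[p]) LK ∧
        IsGreenbergLFunctionAnyRoot₂ ι v vbar κ₁ κ₂ γ₁⁻¹ γ₂⁻¹ f (NumberField.discr K).natAbs
          (NumberField.classNumber K) LK G := by
  intro p _ ι W _ _ K _ _ v vbar κ₁ κ₂ γ₁ γ₂ _ N _ f hf _ hN hp2 hpN hap hK hsplit hv hvbar hne hι hcop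
    hcyc hanti
  obtain ⟨Ω, δ, Ωp, LK, hΩ, hδ, hLK, hall⟩ :=
    h ι K v vbar κ₁ κ₂ γ₁ γ₂ hp2 hK hsplit hv hvbar hne hι hcyc hanti
  obtain ⟨G, hG⟩ := hall W hf hN hpN hap hcop
  exact ⟨Ω, δ, Ωp, LK, G, hΩ, hδ, hLK, hG⟩

/-- The frame conjunct of the odd-prime common-frame binder: under the field data (any odd `p` split in `K`) a Katz
frame exists (this conjunct alone is de Shalit II.4.17 at every `p`, tree fact `DeShalit1987.thmII417_exists_katzSheet`).
Pure logic; asserts nothing about curves.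
[cite: BurungaleSkinnerTianWan2024, Thm. 4.19 (pKatzL, TeX l.3606–3618) (shape only; nothing asserted)] -/
theorem exists_katzFrame_of_commonKatzFrame_odd
    (h : thm617_exists_commonKatzFrame_isGreenbergLFunctionAnyRoot₂_supersingular_odd_PRE)
    {p : ℕ} [Fact p.Prime] (ι : PadicAlgCl p ≃+* ℂ) (K : Type) [Field K] [NumberField K]
    (v vbar : HeightOneSpectrum (𝓞 K)) (κ₁ κ₂ : ZpExtension K p) (γ₁ γ₂ : absoluteGaloisGroup K)
    [Fact (ZpExtension.IsTopGeneratorPair κ₁ κ₂ γ₁ γ₂)] [NeZero (NumberField.discr K).natAbs]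
    (hp : p ≠ 2) (hK : IsImaginaryQuadratic K)
    (hsplit : ((Ideal.span {(p : ℤ)}).primesOver (𝓞 K)).ncard = 2)
    (hv : ((p : ℕ) : 𝓞 K) ∈ v.asIdeal) (hvbar : ((p : ℕ) : 𝓞 K) ∈ vbar.asIdeal) (hne : vbar ≠ v)
    (hι : ∀ (w : InfinitePlace K) (k : 𝓞 K), k ∈ v.asIdeal ↔ ‖ι.symm (w.embedding (k : K))‖ < 1)
    (hcyc : κ₁.IsCyclotomic) (hanti : κ₂.IsAnticyclotomic) :
    ∃ (Ω δ : ℂ) (Ωp : (unrIntegers p)ˣ) (LK : PowerSeries (PowerSeries (PadicComplexInt p))),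
      Ω ≠ 0 ∧ (δ ^ 2 = (NumberField.discr K : ℂ) ∨ δ ^ 2 = -(NumberField.discr K : ℂ)) ∧
      IsKatzMeasure₂ ι v vbar ∅ κ₁ κ₂ γ₁⁻¹ γ₂⁻¹ 1 Ω δ ((Ωp : unrIntegers p) : ℂ_[p]) LK := by
  obtain ⟨Ω, δ, Ωp, LK, hΩ, hδ, hLK, -⟩ :=
    h ι K v vbar κ₁ κ₂ γ₁ γ₂ hp hK hsplit hv hvbar hne hι hcyc hanti
  exact ⟨Ω, δ, Ωp, LK, hΩ, hδ, hLK⟩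

end OddPrime

end Literature.NumberTheory.EllipticCurves.BurungaleSkinnerTianWan2024

end
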